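import Summits.KontsevichZagierPeriods.KontsevichZagierPeriods.Theses.ExpConservative

/-!
# `ExpThesisGlue` (stmt-KontsevichZagierPeriods-14444, route ExpConservative) — proof

`ExpThesisGlue : ExpConservativity → ExpKernelConjecture → ExpThesis`: the two cruxes consumed by the
deciding theorem of route ExpConservative give its thesis `X = ExpKernelConjecture ∧ Conservative`.
Definitional — `ExpThesis` unfolds to
`(∀ c : KZexp.FormalRep, KZexp.eval c = 0 → c ∈ KZexp.relations) ∧ KZexp.Conservative`,
`ExpConservativity` to `KZexp.Conservative` and `ExpKernelConjecture` to the first conjunct, so the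
proof is the anonymous constructor with the hypotheses swapped. Pure logic over the route's own
definitions, no new definitions; planner-proved glue (item docstring: `fun h₁ h₂ => ⟨h₂, h₁⟩`), filed to
clear the route-choice hold `target-unreachable (ExpThesis)` and landed by lead c10 of crux
stmt-KontsevichZagierPeriods-9129 (banking). Sources: M. Kontsevich, D. Zagier, *Periods* (2001) §4.3;
J. Fresán, P. Jossen, *Exponential motives* (2020), Conj. 8.2.6 / Thm 5.1.1.
-/

namespace Summit.KontsevichZagierPeriods.ExpConservative

/-- **`ExpThesisGlue`** (route ExpConservative, stmt-KontsevichZagierPeriods-14444):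
`ExpConservativity → ExpKernelConjecture → ExpThesis`, where `ExpThesis` is verbatim
`ExpKernelConjecture ∧ KZexp.Conservative` and `ExpConservativity := KZexp.Conservative`; proof =
pairing the two hypotheses in the opposite order. [folklore] -/
theorem expThesisGlue_proof :
    Summit.KontsevichZagierPeriods.KontsevichZagierPeriods.Theses.ExpConservative.ExpThesisGlue :=
  fun h₁ h₂ => ⟨h₂, h₁⟩

end Summit.KontsevichZagierPeriods.ExpConservative
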